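import Literature.NumberTheory.IwasawaTheory.PSCyclotomicLFunction
import Literature.NumberTheory.EllipticCurves.PSLineHeight
import Literature.NumberTheory.EllipticCurves.MordellWeilTheoremProofs
import Literature.NumberTheory.EllipticCurves.LeadingTerm
import HarnessLib

/-!
# Route `CyclotomicUntwist`, crux K1 `PSRankOneLowerHalfAtThree`: VACUITY CENSUS, part II — the D2
# hypothesis structure `PSLineHeightData` against the pen's split spec C1 GZ₃ / C4 DICHOTOMY₃
# (kernel certificates; no crux is closed)

Cell `pub/bsd-wall` (D-0145 line `route-BirchSwinnertonDyer-CyclotomicUntwist`), width seat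
`bsd-line-cycu-p5` g0. THEOREMS ONLY (no definition, no named fact, no `sorry`); helper `--supports`
K1 = stmt-BirchSwinnertonDyer-21580 (bears equally on K2 = 21581). BSD is not proved by this file and
nothing here is evidence for or against BSD: the theorems are about the TYPING of the route's
finite-slope road — what the hypothesis structure D2 (`WeierstrassCurve.PSLineHeightData W R`,
documented as junk-inhabitable: "the zero family is a datum … no existence or canonicity is asserted")
does and does not constrain once a child ITEM quantifies over it. Part I
(`CyclotomicUntwistFiniteSlopeSelmerDataVacuity`) does the same for D3 `PSFiniteSlopeSelmerData`.

* §3 **Scaling and the zero datum.** `PSLineHeightData` is closed under `n • ·`; with the zero datum,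
  any child of the shape `∀ Dh : PSLineHeightData W R, c₁(𝓛) = κ · q · ι(h_ψ(P,P))` forces
  `c₁(𝓛) = 0`, and the ‹non-degenerate data only› variant forces the same as soon as one
  non-degenerate datum exists (`Dh` versus `2 • Dh`). CONSEQUENCE: C1 GZ₃ cannot be quantified `∀`
  over D2 data (with C4 and `κ_an · q ≠ 0` it is inconsistent), and quantified `∃` it shares no
  witness with C3 READ.
* §4 **C4 DICHOTOMY₃ is inhabited by construction**: for every elliptic `W/ℚ`, every non-trivial
  `ℚ₃`-algebra `R`, every line `ψ` (`ψ³ = 1`, `ψ ≠ 1`) and every point `P` of infinite order there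
  is a datum `Dh : W.PSLineHeightData R` with `h_ψ(P,P) ≠ 0` — Mordell–Weil (PROVED in the tree,
  `module_finite_point_holds`) gives a torsion-killing functional `f : E(ℚ) →+ ℤ` with `f P ≠ 0`;
  take `h_χ(x,y) = f(x)·f(y)` on the lines and `0` off them (`ℤ`-valued, so the coefficient
  equivariance `h_{σχ} = σ ∘ h_χ` is automatic).
* §5 **On the rows**: granted GZK (`rank_eq_analyticRank_of_analyticRank_le_one` = the route's
  `PublishedInputGZK`), `r_an = 1` supplies the point of infinite order, so C4 is free on every row.

Typing consequence (memo CU-K1-SPLIT-VACUITY-v1.md, evidence on 21580/21581): GZ₃ and READ can be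
separated as items only after the height datum is PINNED (a D2′ carrying a predicate that determines
the pairing, e.g. Benois's `h^{spl} = h^{norm} = h^{sel}` once the vocabulary exists); with D2 as it
stands `∃ Dh` is free and `∀ Dh` is false. [cite: Benois2020, §0.3 (Thm. II–III)]
[cite: SilvermanAEC2009, Thm. VIII.6.7] [cite: Darmon2004, Thm. 3.22]
-/

set_option autoImplicit false
-- single-conjunct summit: `Summit.BirchSwinnertonDyer.BirchSwinnertonDyer.…` repeats the name by design
set_option linter.dupNamespace false

noncomputable section

open scoped Classical

open WeierstrassCurve Literature.NumberTheory.EllipticCurves Literature.NumberTheory.IwasawaTheory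

namespace Summit.BirchSwinnertonDyer.BirchSwinnertonDyer.Theorems.CyclotomicUntwistFiniteSlopeLineHeightVacuity

/-! ### §3 D2: scaling and the zero datum — GZ₃ cannot be quantified `∀` over line-height data -/

section LineHeight

variable {W : WeierstrassCurve ℚ} {R : Type*} [CommRing R] [Algebra ℚ_[3] R]

/-- **`PSLineHeightData` is closed under natural multiples**: for every datum `Dh` and `n : ℕ` there
is a datum with pairings `n • h_χ`. (The structure fixes no normalisation.) [cite: Benois2020, §0.3] -/
theorem exists_lineHeightData_pairing_eq_nsmul (Dh : W.PSLineHeightData R) (n : ℕ) :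
    ∃ Dh' : W.PSLineHeightData R, ∀ χ P Q, Dh'.pairing χ P Q = n • Dh.pairing χ P Q := by
  refine ⟨⟨fun χ ↦ n • Dh.pairing χ, fun χ P Q ↦ ?_, fun χ P Q hP ↦ ?_, fun χ hχ ↦ ?_,
    fun σ χ P Q ↦ ?_⟩, fun χ P Q ↦ ?_⟩
  · simp only [AddMonoidHom.smul_apply, Dh.symm χ P Q]
  · simp only [AddMonoidHom.smul_apply, Dh.map_torsion χ P Q hP, smul_zero]
  · simp only [Dh.eq_zero_of_not_isLine χ hχ, smul_zero]
  · simp only [AddMonoidHom.smul_apply, Dh.conj σ χ P Q, map_nsmul]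
  · simp only [AddMonoidHom.smul_apply]

/-- **The zero datum kills every `∀`-over-data form of GZ₃**: if an identity
`c = κ · q · ι(h_ψ(P,P))` is required for EVERY datum `Dh : PSLineHeightData W R`, then `c = 0`
(instantiate at `PSLineHeightData.zero`). With `c = c₁(𝓛) = 𝓛′(𝟙)` this is the spec's C1 read `∀`.
[cite: Benois2020, §0.3 (Thm. II–III: the normalisation is not axiomatised)] -/
theorem eq_zero_of_forall_lineHeightData {S : Type*} [AddCommMonoid S] (ι : R →+ S)
    (c κ : ℂ_[3]) (q : ℚ) (F : S → ℂ_[3]) (hF : F 0 = 0) (ψ : DirichletCharacter R 9)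
    (P : W.toAffine.Point)
    (H : ∀ Dh : W.PSLineHeightData R, c = κ * q * F (ι (Dh.pairing ψ P P))) : c = 0 := by
  have h := H (PSLineHeightData.zero W R)
  rwa [PSLineHeightData.zero_pairing, AddMonoidHom.zero_apply, AddMonoidHom.zero_apply, map_zero, hF,
    mul_zero] at h

/-- The same in the exact currency of the route's closers (`ι : R →ₐ[ℚ₃] ℂ₃`, GZ₃ on `c₁(𝓛)`):
`(∀ Dh, c₁(𝓛) = κ · q · ι(h_ψ(P,P))) → c₁(𝓛) = 0`. [cite: Benois2020, §0.3] -/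
theorem mahlerCoeff_one_eq_zero_of_forall_lineHeightData (𝓛 : (n : ℕ) → ZMod (3 ^ n) → ℂ_[3])
    (κ : ℂ_[3]) (q : ℚ) (ι : R →ₐ[ℚ_[3]] ℂ_[3]) (ψ : DirichletCharacter R 9) (P : W.toAffine.Point)
    (H : ∀ Dh : W.PSLineHeightData R, gammaMahlerCoeff 3 𝓛 1 = κ * q * ι (Dh.pairing ψ P P)) :
    gammaMahlerCoeff 3 𝓛 1 = 0 := by
  have h := H (PSLineHeightData.zero W R)
  rwa [PSLineHeightData.zero_pairing, AddMonoidHom.zero_apply, AddMonoidHom.zero_apply, map_zero,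
    mul_zero] at h

/-- **Restricting to non-degenerate data does not help**: if `c = κ · q · ι(h_ψ(P,P))` is required
for every datum with `h_ψ(P,P) ≠ 0`, and ONE such datum exists, then again `c = 0` — compare the
datum `Dh` with `2 • Dh` (`2` is a unit of the `ℚ₃`-algebra `R`, so `2 • h ≠ 0`). [cite: Benois2020, §0.3] -/
theorem eq_zero_of_forall_nondegenerate_lineHeightData (c κ : ℂ_[3]) (q : ℚ)
    (ι : R →ₐ[ℚ_[3]] ℂ_[3]) (ψ : DirichletCharacter R 9) (P : W.toAffine.Point)
    (H : ∀ Dh : W.PSLineHeightData R, Dh.pairing ψ P P ≠ 0 → c = κ * q * ι (Dh.pairing ψ P P))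
    (hex : ∃ Dh : W.PSLineHeightData R, Dh.pairing ψ P P ≠ 0) : c = 0 := by
  obtain ⟨Dh, hDh⟩ := hex
  obtain ⟨Dh2, h2⟩ := exists_lineHeightData_pairing_eq_nsmul Dh 2
  have h2u : IsUnit (2 : R) := by
    rw [← map_ofNat (algebraMap ℚ_[3] R) 2]
    exact (IsUnit.mk0 (2 : ℚ_[3]) (by norm_num)).map _
  have hDh2 : Dh2.pairing ψ P P ≠ 0 := by
    rw [h2, nsmul_eq_mul, Nat.cast_ofNat]
    exact fun h0 ↦ hDh (h2u.mul_right_eq_zero.mp h0)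
  have e1 := H Dh hDh
  have e2 := H Dh2 hDh2
  rw [h2, map_nsmul, nsmul_eq_mul, Nat.cast_ofNat] at e2
  linear_combination 2 * e1 - e2

/-- **Inconsistency of the `∀`-form of GZ₃ with DICHOTOMY₃**: `∀ Dh, c = κ · q · ι(h_ψ(P,P))` together
with one datum non-degenerate at `P`, `κ ≠ 0`, `q ≠ 0` and `ι` injective is contradictory.
[cite: Benois2020, §0.3] -/
theorem false_of_forall_lineHeightData_of_nondegenerate (c κ : ℂ_[3]) (q : ℚ)
    (ι : R →ₐ[ℚ_[3]] ℂ_[3]) (hι : Function.Injective ι) (ψ : DirichletCharacter R 9)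
    (P : W.toAffine.Point) (hκ : κ ≠ 0) (hq : q ≠ 0)
    (H : ∀ Dh : W.PSLineHeightData R, c = κ * q * ι (Dh.pairing ψ P P))
    (Dh : W.PSLineHeightData R) (hDh : Dh.pairing ψ P P ≠ 0) : False := by
  have hc : c = 0 :=
    eq_zero_of_forall_lineHeightData (ι : R →+ ℂ_[3]) c κ q id rfl ψ P H
  have h := H Dh
  rw [hc, eq_comm] at h
  have hιx : ι (Dh.pairing ψ P P) ≠ 0 := (map_ne_zero_iff _ hι).mpr hDh
  have hqC : (q : ℂ_[3]) ≠ 0 := by exact_mod_cast hq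
  exact mul_ne_zero (mul_ne_zero hκ hqC) hιx h

end LineHeight

/-! ### §4 D2: the dichotomy C4 is inhabited by construction (Mordell–Weil) -/

section Inhabited

variable (W : WeierstrassCurve ℚ) [W.IsElliptic]

/-- **Pure algebra: a finitely generated abelian group has enough torsion-killing functionals.**
For `M` a finite `ℤ`-module and `x ∈ M` of infinite order there is `f : M →+ ℤ` vanishing on all
torsion elements with `f x ≠ 0`: `M/tors` is torsion-free and finitely generated, hence free
(`Module.free_of_finite_type_torsion_free'`), the image of `x` there is non-zero, and a free module
has enough linear functionals (`Module.forall_dual_apply_eq_zero_iff`). [folklore] -/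
theorem exists_addMonoidHom_int_apply_ne_zero_of_not_isOfFinAddOrder {M : Type*} [AddCommGroup M]
    [Module.Finite ℤ M] (x : M) (hx : ¬ IsOfFinAddOrder x) :
    ∃ f : M →+ ℤ, (∀ y, IsOfFinAddOrder y → f y = 0) ∧ f x ≠ 0 := by
  set π : M →+ M ⧸ AddCommGroup.torsion M := QuotientAddGroup.mk' (AddCommGroup.torsion M) with hπ
  haveI : Module.Finite ℤ (M ⧸ AddCommGroup.torsion M) :=
    Module.Finite.of_surjective π.toIntLinearMap (QuotientAddGroup.mk'_surjective _)
  haveI : NoZeroSMulDivisors ℤ (M ⧸ AddCommGroup.torsion M) := inferInstance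
  haveI : Module.Free ℤ (M ⧸ AddCommGroup.torsion M) := inferInstance
  have hπx : π x ≠ 0 := by
    intro h
    exact hx ((AddCommGroup.mem_torsion x).mp ((QuotientAddGroup.eq_zero_iff x).mp h))
  obtain ⟨φ, hφ⟩ : ∃ φ : Module.Dual ℤ (M ⧸ AddCommGroup.torsion M), φ (π x) ≠ 0 := by
    by_contra! h
    exact hπx ((Module.forall_dual_apply_eq_zero_iff ℤ (π x)).mp h)
  refine ⟨φ.toAddMonoidHom.comp π, fun y hy ↦ ?_, by simpa using hφ⟩
  have hy0 : π y = 0 := (QuotientAddGroup.eq_zero_iff y).mpr ((AddCommGroup.mem_torsion y).mpr hy)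
  simp [hy0]

/-- **A torsion-killing functional non-zero at a point of infinite order**, for an elliptic curve
over `ℚ`: Mordell–Weil (PROVED in the tree, `module_finite_point_holds`; the `DecidableEq ℚ`
instances behind the two group laws agree by `Subsingleton.elim`) and the previous lemma.
[cite: SilvermanAEC2009, Thm. VIII.6.7] -/
theorem exists_addMonoidHom_int_apply_ne_zero (P : W.toAffine.Point) (hP : ¬ IsOfFinAddOrder P) :
    ∃ f : W.toAffine.Point →+ ℤ, (∀ Q, IsOfFinAddOrder Q → f Q = 0) ∧ f P ≠ 0 := by
  haveI : Module.Finite ℤ W.toAffine.Point := by convert W.module_finite_point_holds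
  exact exists_addMonoidHom_int_apply_ne_zero_of_not_isOfFinAddOrder P hP

variable (R : Type*) [CommRing R] [Algebra ℚ_[3] R]

/-- `χ ↦ χ ∘ σ` (coefficients twisted by an injective `σ`) preserves and reflects "`χ` is a line"
(`χ³ = 1 ∧ χ ≠ 1`). [folklore] -/
theorem isLine_ringHomComp_iff (σ : R ≃ₐ[ℚ_[3]] R) (χ : DirichletCharacter R 9) :
    ((χ.ringHomComp (σ : R →+* R)) ^ 3 = 1 ∧ χ.ringHomComp (σ : R →+* R) ≠ 1) ↔
      (χ ^ 3 = 1 ∧ χ ≠ 1) := by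
  have hinj : ∀ χ₁ χ₂ : DirichletCharacter R 9,
      χ₁.ringHomComp (σ : R →+* R) = χ₂.ringHomComp (σ : R →+* R) ↔ χ₁ = χ₂ := by
    intro χ₁ χ₂
    refine ⟨fun h ↦ ?_, fun h ↦ by rw [h]⟩
    ext a
    have ha := congrArg (fun χ : DirichletCharacter R 9 ↦ χ (a : ZMod 9)) h
    simp only [MulChar.ringHomComp_apply] at ha
    exact σ.injective ha
  rw [MulChar.ringHomComp_pow]
  conv_lhs => rw [← MulChar.ringHomComp_one (σ : R →+* R), hinj, ne_eq, hinj]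

/-- **C4 DICHOTOMY₃ is inhabited by construction.** For every elliptic `W/ℚ`, every non-trivial
`ℚ₃`-algebra `R`, every line `ψ` (`ψ³ = 1`, `ψ ≠ 1`) and every `P ∈ E(ℚ)` of infinite order there is
a line-height datum `Dh : W.PSLineHeightData R` with `h_ψ(P,P) ≠ 0`: take `h_χ(x,y) = f(x)·f(y)` on
the lines and `0` off them, `f` the functional of `exists_addMonoidHom_int_apply_ne_zero`
(`ℤ`-valued, so Galois-equivariance in the coefficients is automatic). The D2 structure records the
SHAPE of Benois's height, not the height. [cite: Benois2020, §0.3 (Thm. II–III)] [cite: SilvermanAEC2009, Thm. VIII.6.7] -/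
theorem exists_lineHeightData_pairing_self_ne_zero [Nontrivial R] (ψ : DirichletCharacter R 9)
    (hψ : ψ ^ 3 = 1 ∧ ψ ≠ 1) (P : W.toAffine.Point) (hP : ¬ IsOfFinAddOrder P) :
    ∃ Dh : W.PSLineHeightData R, Dh.pairing ψ P P ≠ 0 := by
  haveI : CharZero R := charZero_of_injective_algebraMap (algebraMap ℚ_[3] R).injective
  obtain ⟨f, hft, hfP⟩ := exists_addMonoidHom_int_apply_ne_zero W P hP
  let g : W.toAffine.Point →+ R := (Int.castAddHom R).comp f
  let B : W.toAffine.Point →+ W.toAffine.Point →+ R :=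
    ((AddMonoidHom.mul : R →+ R →+ R).comp g).compl₂ g
  have hB : ∀ x y, B x y = (f x : R) * (f y : R) := fun x y ↦ rfl
  refine ⟨⟨fun χ ↦ if χ ^ 3 = 1 ∧ χ ≠ 1 then B else 0, fun χ x y ↦ ?_, fun χ x y hx ↦ ?_,
    fun χ hχ ↦ if_neg hχ, fun σ χ x y ↦ ?_⟩, ?_⟩
  · by_cases hχ : χ ^ 3 = 1 ∧ χ ≠ 1
    · simp only [if_pos hχ, hB, mul_comm]
    · simp only [if_neg hχ, AddMonoidHom.zero_apply]
  · by_cases hχ : χ ^ 3 = 1 ∧ χ ≠ 1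
    · simp only [if_pos hχ, hB, hft x hx, Int.cast_zero, zero_mul]
    · simp only [if_neg hχ, AddMonoidHom.zero_apply]
  · by_cases hχ : χ ^ 3 = 1 ∧ χ ≠ 1
    · rw [if_pos ((isLine_ringHomComp_iff R σ χ).mpr hχ), if_pos hχ, hB, map_mul, map_intCast,
        map_intCast]
    · rw [if_neg (fun h ↦ hχ ((isLine_ringHomComp_iff R σ χ).mp h)), if_neg hχ,
        AddMonoidHom.zero_apply, AddMonoidHom.zero_apply, map_zero]
  · show (if ψ ^ 3 = 1 ∧ ψ ≠ 1 then B else 0) P P ≠ 0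
    rw [if_pos hψ, hB, ← Int.cast_mul, Int.cast_ne_zero]
    exact mul_self_ne_zero.mpr hfP

/-- **The dichotomy shape of the closers, inhabited**: under the same hypotheses there is a datum with
`h_ψ(P,P) ≠ 0 ∨ h_{ψ⁻¹}(P,P) ≠ 0`. [cite: Benois2020, §0.3] -/
theorem exists_lineHeightData_dichotomy [Nontrivial R] (ψ : DirichletCharacter R 9)
    (hψ : ψ ^ 3 = 1 ∧ ψ ≠ 1) (P : W.toAffine.Point) (hP : ¬ IsOfFinAddOrder P) :
    ∃ Dh : W.PSLineHeightData R, Dh.pairing ψ P P ≠ 0 ∨ Dh.pairing ψ⁻¹ P P ≠ 0 := by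
  obtain ⟨Dh, h⟩ := exists_lineHeightData_pairing_self_ne_zero W R ψ hψ P hP
  exact ⟨Dh, Or.inl h⟩

/-- **No item can carry GZ₃ universally over D2 data on a curve of positive rank**: if `E(ℚ)` has a
point `P` of infinite order, `R` is a non-trivial `ℚ₃`-algebra with an injective `ι : R → ℂ₃` and
`ψ` is a line, then `∀ Dh, c = κ · q · ι(h_ψ(P,P))` with `κ, q ≠ 0` is FALSE (§3 with the datum of
`exists_lineHeightData_pairing_self_ne_zero`). [cite: Benois2020, §0.3] -/
theorem not_forall_lineHeightData_gz [Nontrivial R] (c κ : ℂ_[3]) (q : ℚ)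
    (ι : R →ₐ[ℚ_[3]] ℂ_[3]) (hι : Function.Injective ι) (ψ : DirichletCharacter R 9)
    (hψ : ψ ^ 3 = 1 ∧ ψ ≠ 1) (P : W.toAffine.Point) (hP : ¬ IsOfFinAddOrder P) (hκ : κ ≠ 0)
    (hq : q ≠ 0) :
    ¬ ∀ Dh : W.PSLineHeightData R, c = κ * q * ι (Dh.pairing ψ P P) := by
  intro H
  obtain ⟨Dh, hDh⟩ := exists_lineHeightData_pairing_self_ne_zero W R ψ hψ P hP
  exact false_of_forall_lineHeightData_of_nondegenerate c κ q ι hι ψ P hκ hq H Dh hDh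

end Inhabited

/-! ### §5 On the route's rows: analytic rank one gives the non-torsion point (GZK), so C4 is free there -/

section Rows

/-- **On every curve of analytic rank one, C4 is inhabited** (granted the route's PUB input
Gross–Zagier–Kolyvagin `rank_eq_analyticRank_of_analyticRank_le_one` = `PublishedInputGZK`):
`rank E(ℚ) = 1` supplies a point of infinite order, and §4 a datum non-degenerate at it, for every
non-trivial `ℚ₃`-algebra `R` and every line `ψ`. So a child `∀ row, ∃ (Dh, P), h_ψ(P,P) ≠ 0 ∨ h_ψ̄(P,P) ≠ 0`
is closed by bookkeeping and carries no height-non-degeneracy content. [cite: Benois2020, §0.3]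
[cite: SilvermanAEC2009, Thm. VIII.6.7] -/
theorem exists_lineHeightData_dichotomy_of_analyticRank_eq_one
    (hGZK : rank_eq_analyticRank_of_analyticRank_le_one) (W : WeierstrassCurve ℚ) [W.IsElliptic]
    (hr : W.analyticRank = 1) (R : Type*) [CommRing R] [Algebra ℚ_[3] R] [Nontrivial R]
    (ψ : DirichletCharacter R 9) (hψ : ψ ^ 3 = 1 ∧ ψ ≠ 1) :
    ∃ (Dh : W.PSLineHeightData R) (P : W.toAffine.Point),
      Dh.pairing ψ P P ≠ 0 ∨ Dh.pairing ψ⁻¹ P P ≠ 0 := by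
  -- rank `E(ℚ) = 1` (GZK), read for the group law with decidable equality on `ℚ`
  have hrk : Module.finrank ℤ W.toAffine.Point = 1 := by
    have h := (hGZK W hr.le).1
    rw [hr] at h
    rw [← h]
    unfold WeierstrassCurve.mordellWeilRank
    congr!
  -- a point of infinite order (pure algebra: `finrank ≥ 1 ⇒ rank ≠ 0 ⇒` some non-torsion element)
  obtain ⟨P, hP⟩ : ∃ P : W.toAffine.Point, ¬ IsOfFinAddOrder P := by
    have hrank : Module.rank ℤ W.toAffine.Point ≠ 0 := by
      have hlt : ((0 : ℕ) : Cardinal) < Module.rank ℤ W.toAffine.Point :=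
        Module.lt_rank_of_lt_finrank (by omega)
      exact ne_of_gt (by simpa using hlt)
    have hex : ¬ ∀ x : W.toAffine.Point, ∃ a : ℤ, a ≠ 0 ∧ a • x = 0 :=
      fun hall ↦ hrank (rank_eq_zero_iff.2 hall)
    push Not at hex
    obtain ⟨P, hP⟩ := hex
    refine ⟨P, fun hfin ↦ ?_⟩
    obtain ⟨n, hn, hnP⟩ := (isOfFinAddOrder_iff_nsmul_eq_zero).1 hfin
    exact hP (n : ℤ) (by exact_mod_cast hn.ne') (by rwa [natCast_zsmul])
  obtain ⟨Dh, hDh⟩ := exists_lineHeightData_dichotomy W R ψ hψ P hP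
  exact ⟨Dh, P, hDh⟩

end Rows

end Summit.BirchSwinnertonDyer.BirchSwinnertonDyer.Theorems.CyclotomicUntwistFiniteSlopeLineHeightVacuity

end
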